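import Literature.Topology.FourManifolds.KirbyMovesSlideSweepExchange
import HarnessLib

/-!
# The handle-slide sweep, planar part IV: the cap graphs of the twisted slice

Topic `Literature/Topology/FourManifolds`; fact seat `provefact-IsStrictHandleSlide.isSurgery`
(R. C. Kirby, *The Topology of 4-Manifolds*, LNM 1374 (1989), Ch. I §4, p. 10, Figs. 4.2–4.3 and
§5 Thm. 5.1 (1); remaining content in the tree: the named fact (S)
`Literature.Topology.FourManifolds.FramedLink.IsStrictHandleSlide.slideModel`,
`KirbyMovesHandleSlide.lean`). Continuation of `KirbyMovesSlideSweepExchange.lean`.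

In the twisted chart `Λ` of a meridian slice (`exists_twistDiffeomorph`) the two arcs exchanged
by the sweep across the disc `Δ` — the slid attaching circle before and after the slide, near
`Δ` — are the graphs `x = g₂(y)` and `x = g₁(y)` of two even functions over a common interval
`[-Y, Y]`, meeting the vertical axis flatly at the two tips `(0, ±Y)`: `g₁ = -capGraph R …` (its
middle piece `-√(R² - y²)` is the image of the long arc of the push-off `Kⱼ'`, the circle of
radius `R`), `g₂ = capGraph (R + ε) …` (the fingertip). This file defines the **cap graphs** and
proves the elementary properties the exchange and the assembly need:

* `Literature.Topology.FourManifolds.SlideSweep.stepUp`, `cutoff`, `plateau` — smooth steps,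
  even cut-offs and even plateaus built from Mathlib's `Real.smoothTransition`;
* `Literature.Topology.FourManifolds.SlideSweep.capGraph ρ₀ ρ₁ β a₁ b₁ a₂ b₂ Y` — the even
  function equal to `√(ρ₀² - y²)` for `|y| ≤ a₁`, blended into `√(ρ₁² - y²)` over `a₁ ≤ |y| ≤ b₁`,
  kept there up to `|y| = a₂`, blended over `a₂ ≤ |y| ≤ b₂` into the flat tail `β · plateau`,
  which vanishes exactly for `|y| ≥ Y`; with `0 < a₁ < b₁ < ρ₀ ≤ a₂ < b₂ < ρ₁`, `b₂ < Y`, `0 < β`: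
  smooth (`contDiff_capGraph`), positive on `(-Y, Y)` and zero off it, bounded below by
  `√(ρ₀² - y²)` (the graph stays outside the circle of radius `ρ₀`) and above by
  `max √(ρ₁² - y²) β` (it stays inside the pillbox).

Everything is proved; the only new declarations are these four real functions (no named facts).

## References

* R. C. Kirby, *The Topology of 4-Manifolds*, LNM 1374, Springer (1989), Ch. I §4, §5 Thm. 5.1.
  [Kirby1989]
* M. W. Hirsch, *Differential Topology*, GTM 33, Springer (1976), Ch. 8 §1 (cut-off functions in
  isotopy constructions). [HirschDT1976]
-/

open scoped ContDiff Topology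
open Function Set

noncomputable section

namespace Literature.Topology.FourManifolds

namespace SlideSweep

/-! ## Smooth steps -/

/-- The **smooth step** from `0` (for `y ≤ a`) to `1` (for `y ≥ b`):
`stepUp a b y = smoothTransition ((y - a)/(b - a))`. [folklore] -/
def stepUp (a b y : ℝ) : ℝ := Real.smoothTransition ((y - a) / (b - a))

/-- The smooth step is smooth in `y`. [folklore] -/
theorem contDiff_stepUp (a b : ℝ) : ContDiff ℝ ∞ (stepUp a b) :=
  Real.smoothTransition.contDiff.comp ((contDiff_id.sub contDiff_const).div_const _)

/-- The smooth step vanishes for `y ≤ a` (`a < b`). [folklore] -/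
theorem stepUp_of_le_left {a b y : ℝ} (hab : a < b) (h : y ≤ a) : stepUp a b y = 0 :=
  Real.smoothTransition.zero_of_nonpos (div_nonpos_of_nonpos_of_nonneg (by linarith) (by linarith))

/-- The smooth step is `1` for `b ≤ y` (`a < b`). [folklore] -/
theorem stepUp_of_right_le {a b y : ℝ} (hab : a < b) (h : b ≤ y) : stepUp a b y = 1 :=
  Real.smoothTransition.one_of_one_le ((one_le_div (by linarith)).2 (by linarith))

/-- The smooth step takes values in `[0, 1]`. [folklore] -/
theorem stepUp_mem_Icc (a b y : ℝ) : stepUp a b y ∈ Icc (0 : ℝ) 1 :=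
  ⟨Real.smoothTransition.nonneg _, Real.smoothTransition.le_one _⟩

/-- The smooth step is positive for `a < y` (`a < b`). [folklore] -/
theorem stepUp_pos {a b y : ℝ} (hab : a < b) (h : a < y) : 0 < stepUp a b y :=
  Real.smoothTransition.pos_of_pos (div_pos (by linarith) (by linarith))

/-- The smooth step is `< 1` for `y < b` (`a < b`). [folklore] -/
theorem stepUp_lt_one {a b y : ℝ} (hab : a < b) (h : y < b) : stepUp a b y < 1 :=
  Real.smoothTransition.lt_one_of_lt_one ((div_lt_one (by linarith)).2 (by linarith))

/-! ## Even cut-offs and plateaus -/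

/-- The **even cut-off** `cutoff a b`: `0` on `[-a, a]`, `1` off `(-b, b)`, for `0 < a < b`
(the sum of the step and its mirror image, which have disjoint supports). [folklore] -/
def cutoff (a b y : ℝ) : ℝ := stepUp a b y + stepUp a b (-y)

/-- The even cut-off is smooth. [folklore] -/
theorem contDiff_cutoff (a b : ℝ) : ContDiff ℝ ∞ (cutoff a b) :=
  (contDiff_stepUp a b).add ((contDiff_stepUp a b).comp contDiff_neg)

/-- The even cut-off is even. [folklore] -/
theorem cutoff_neg (a b y : ℝ) : cutoff a b (-y) = cutoff a b y := by
  simp only [cutoff, neg_neg]; ring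

/-- The even cut-off vanishes on `[-a, a]`. [folklore] -/
theorem cutoff_of_abs_le {a b y : ℝ} (hab : a < b) (h : |y| ≤ a) : cutoff a b y = 0 := by
  rw [cutoff, stepUp_of_le_left hab (le_of_abs_le h),
    stepUp_of_le_left hab (by linarith [(abs_le.1 h).1]), add_zero]

/-- The even cut-off is `1` off `(-b, b)` (`0 < a < b`). [folklore] -/
theorem cutoff_of_le_abs {a b y : ℝ} (ha : 0 < a) (hab : a < b) (h : b ≤ |y|) : cutoff a b y = 1 := by
  rw [cutoff]
  rcases le_or_gt 0 y with hy | hy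
  · rw [abs_of_nonneg hy] at h
    rw [stepUp_of_right_le hab h, stepUp_of_le_left hab (by linarith), add_zero]
  · rw [abs_of_neg hy] at h
    rw [stepUp_of_le_left hab (by linarith), stepUp_of_right_le hab h, zero_add]

/-- The even cut-off takes values in `[0, 1]` (`0 < a < b`). [folklore] -/
theorem cutoff_mem_Icc {a b : ℝ} (ha : 0 < a) (hab : a < b) (y : ℝ) : cutoff a b y ∈ Icc (0 : ℝ) 1 := by
  rw [cutoff]
  rcases le_or_gt 0 y with hy | hy
  · rw [stepUp_of_le_left hab (show -y ≤ a by linarith), add_zero]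
    exact stepUp_mem_Icc a b y
  · rw [stepUp_of_le_left hab (show y ≤ a by linarith), zero_add]
    exact stepUp_mem_Icc a b (-y)

/-- The even cut-off is positive off `[-a, a]` (`0 < a < b`). [folklore] -/
theorem cutoff_pos {a b y : ℝ} (hab : a < b) (h : a < |y|) : 0 < cutoff a b y := by
  rw [cutoff]
  rcases le_or_gt 0 y with hy | hy
  · rw [abs_of_nonneg hy] at h
    exact add_pos_of_pos_of_nonneg (stepUp_pos hab h) (stepUp_mem_Icc _ _ _).1
  · rw [abs_of_neg hy] at h
    exact add_pos_of_nonneg_of_pos (stepUp_mem_Icc _ _ _).1 (stepUp_pos hab h)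

/-- The even cut-off is `< 1` on `(-b, b)` (`0 < a < b`). [folklore] -/
theorem cutoff_lt_one {a b y : ℝ} (ha : 0 < a) (hab : a < b) (h : |y| < b) : cutoff a b y < 1 := by
  rw [cutoff]
  rcases le_or_gt 0 y with hy | hy
  · rw [stepUp_of_le_left hab (show -y ≤ a by linarith), add_zero]
    exact stepUp_lt_one hab (lt_of_abs_lt h)
  · rw [stepUp_of_le_left hab (show y ≤ a by linarith), zero_add]
    exact stepUp_lt_one hab (by rw [abs_of_neg hy] at h; exact h)

/-- The **even plateau** `plateau a b`: `1` on `[-a, a]`, `0` off `(-b, b)`, positive in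
between, flat at `±b` (product of a step and its mirror image), for `a < b`. [folklore] -/
def plateau (a b y : ℝ) : ℝ := stepUp (-b) (-a) y * stepUp (-b) (-a) (-y)

/-- The even plateau is smooth. [folklore] -/
theorem contDiff_plateau (a b : ℝ) : ContDiff ℝ ∞ (plateau a b) :=
  (contDiff_stepUp _ _).mul ((contDiff_stepUp _ _).comp contDiff_neg)

/-- The even plateau is even. [folklore] -/
theorem plateau_neg (a b y : ℝ) : plateau a b (-y) = plateau a b y := by
  simp only [plateau, neg_neg]; ring

/-- The even plateau is `1` on `[-a, a]` (`a < b`). [folklore] -/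
theorem plateau_of_abs_le {a b y : ℝ} (hab : a < b) (h : |y| ≤ a) : plateau a b y = 1 := by
  rw [plateau, stepUp_of_right_le (by linarith) (by linarith [neg_le_of_abs_le h]),
    stepUp_of_right_le (by linarith) (by linarith [le_of_abs_le h]), mul_one]

/-- The even plateau vanishes off `(-b, b)` (`a < b`). [folklore] -/
theorem plateau_of_le_abs {a b y : ℝ} (hab : a < b) (h : b ≤ |y|) : plateau a b y = 0 := by
  rw [plateau]
  rcases le_or_gt 0 y with hy | hy
  · rw [abs_of_nonneg hy] at h
    rw [stepUp_of_le_left (b := -a) (by linarith) (show -y ≤ -b by linarith), mul_zero]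
  · rw [abs_of_neg hy] at h
    rw [stepUp_of_le_left (b := -a) (by linarith) (show y ≤ -b by linarith), zero_mul]

/-- The even plateau takes values in `[0, 1]`. [folklore] -/
theorem plateau_mem_Icc (a b y : ℝ) : plateau a b y ∈ Icc (0 : ℝ) 1 := by
  obtain ⟨h1, h2⟩ := stepUp_mem_Icc (-b) (-a) y
  obtain ⟨h3, h4⟩ := stepUp_mem_Icc (-b) (-a) (-y)
  exact ⟨mul_nonneg h1 h3, mul_le_one₀ h2 h3 h4⟩

/-- The even plateau is positive on `(-b, b)` (`a < b`). [folklore] -/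
theorem plateau_pos {a b y : ℝ} (hab : a < b) (h : |y| < b) : 0 < plateau a b y := by
  obtain ⟨h1, h2⟩ := abs_lt.1 h
  exact mul_pos (stepUp_pos (by linarith) (by linarith)) (stepUp_pos (by linarith) (by linarith))

/-! ## The cap graph -/

/-- **The cap graph** of the twisted slice. For radii `ρ₀ ≤ ρ₁`, a tail height `β` and marks
`a₁ < b₁`, `a₂ < b₂`, `Y`:
`capGraph y = (1 - χ₁ y) √(ρ₀² - y²) + χ₁ y (1 - χ₂ y) √(ρ₁² - y²) + χ₂ y · β · plateau b₂ Y y`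
with `χᵢ = cutoff aᵢ bᵢ` — the circle of radius `ρ₀` over `|y| ≤ a₁`, blended into the circle of
radius `ρ₁`, blended into a flat tail meeting the vertical axis at height `|y| = Y`. In the
handle-slide sweep (Kirby (1989), Ch. I §4, Figs. 4.2–4.3, read in the twisted chart of the
meridian slice of the surgered tube) `-capGraph R …` is the long arc of the push-off `Kⱼ'` with
its two flanks and `capGraph (R + ε) …` is the fingertip of the slid circle before the sweep.
[cite: Kirby1989, Ch. I §4] -/
def capGraph (ρ₀ ρ₁ β a₁ b₁ a₂ b₂ Y : ℝ) (y : ℝ) : ℝ :=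
  (1 - cutoff a₁ b₁ y) * Real.sqrt (ρ₀ ^ 2 - y ^ 2) +
    cutoff a₁ b₁ y * (1 - cutoff a₂ b₂ y) * Real.sqrt (ρ₁ ^ 2 - y ^ 2) +
    cutoff a₂ b₂ y * β * plateau b₂ Y y

section CapGraph

variable {ρ₀ ρ₁ β a₁ b₁ a₂ b₂ Y : ℝ}

/-- The cap graph is even. [folklore] -/
theorem capGraph_neg (y : ℝ) :
    capGraph ρ₀ ρ₁ β a₁ b₁ a₂ b₂ Y (-y) = capGraph ρ₀ ρ₁ β a₁ b₁ a₂ b₂ Y y := by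
  simp only [capGraph, cutoff_neg, plateau_neg, neg_sq]

/-- A product `(1 - cutoff a b y) √(ρ² - y²)` with `0 < a < b < ρ` is smooth: near `|y| ≥ ρ` the
first factor vanishes identically, elsewhere the square root is smooth. [folklore] -/
theorem contDiff_one_sub_cutoff_mul_sqrt {a b ρ : ℝ} (ha : 0 < a) (hab : a < b) (hbρ : b < ρ) :
    ContDiff ℝ ∞ fun y ↦ (1 - cutoff a b y) * Real.sqrt (ρ ^ 2 - y ^ 2) := by
  refine contDiff_iff_contDiffAt.2 fun y ↦ ?_
  by_cases hy : |y| < ρ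
  · -- the square root is smooth here
    have hpos : ρ ^ 2 - y ^ 2 ≠ 0 := by
      have : y ^ 2 < ρ ^ 2 := by
        have := abs_lt.1 hy
        nlinarith [abs_nonneg y, sq_abs y]
      linarith
    exact ((contDiff_const.sub (contDiff_cutoff a b)).contDiffAt).mul
      ((Real.contDiffAt_sqrt hpos).comp y (contDiff_const.sub (contDiff_id.pow 2)).contDiffAt)
  · -- the product vanishes on a neighbourhood
    push Not at hy
    have hb : b < |y| := lt_of_lt_of_le hbρ hy
    have hev : (fun y' ↦ (1 - cutoff a b y') * Real.sqrt (ρ ^ 2 - y' ^ 2)) =ᶠ[𝓝 y]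
        fun _ ↦ (0 : ℝ) := by
      have hopen : IsOpen {y' : ℝ | b < |y'|} := isOpen_lt continuous_const continuous_abs
      filter_upwards [hopen.mem_nhds hb] with y' hy'
      rw [cutoff_of_le_abs ha hab hy'.le, sub_self, zero_mul]
    exact (contDiffAt_const.congr_of_eventuallyEq hev)

/-- A product `cutoff a₁ b₁ y (1 - cutoff a₂ b₂ y) √(ρ² - y²)` with `0 < a₂ < b₂ < ρ` is smooth.
[folklore] -/
theorem contDiff_cutoff_mul_one_sub_cutoff_mul_sqrt {a₁ b₁ a₂ b₂ ρ : ℝ} (ha : 0 < a₂)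
    (hab : a₂ < b₂) (hbρ : b₂ < ρ) :
    ContDiff ℝ ∞ fun y ↦ cutoff a₁ b₁ y * (1 - cutoff a₂ b₂ y) * Real.sqrt (ρ ^ 2 - y ^ 2) := by
  have h := (contDiff_cutoff a₁ b₁).mul (contDiff_one_sub_cutoff_mul_sqrt ha hab hbρ)
  have h' : (fun y ↦ cutoff a₁ b₁ y * (1 - cutoff a₂ b₂ y) * Real.sqrt (ρ ^ 2 - y ^ 2)) =
      fun y ↦ cutoff a₁ b₁ y * ((1 - cutoff a₂ b₂ y) * Real.sqrt (ρ ^ 2 - y ^ 2)) := by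
    funext y; ring
  rw [h']
  exact h

/-- **The cap graph is smooth** (`0 < a₁ < b₁ < ρ₀`, `0 < a₂ < b₂ < ρ₁`). [folklore] -/
theorem contDiff_capGraph (ha₁ : 0 < a₁) (hab₁ : a₁ < b₁) (hb₁ : b₁ < ρ₀) (ha₂ : 0 < a₂)
    (hab₂ : a₂ < b₂) (hb₂ : b₂ < ρ₁) :
    ContDiff ℝ ∞ (capGraph ρ₀ ρ₁ β a₁ b₁ a₂ b₂ Y) := by
  unfold capGraph
  exact ((contDiff_one_sub_cutoff_mul_sqrt ha₁ hab₁ hb₁).add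
    (contDiff_cutoff_mul_one_sub_cutoff_mul_sqrt ha₂ hab₂ hb₂)).add
    (((contDiff_cutoff a₂ b₂).mul contDiff_const).mul (contDiff_plateau b₂ Y))

/-- **Middle piece**: for `|y| ≤ a₁` (and `a₁ ≤ a₂`, `a₁ < b₁`, `a₂ < b₂`) the cap graph is the
circle of radius `ρ₀`: `capGraph y = √(ρ₀² - y²)`. [folklore] -/
theorem capGraph_of_abs_le (hab₁ : a₁ < b₁) (hab₂ : a₂ < b₂) (h12 : a₁ ≤ a₂) {y : ℝ}
    (hy : |y| ≤ a₁) : capGraph ρ₀ ρ₁ β a₁ b₁ a₂ b₂ Y y = Real.sqrt (ρ₀ ^ 2 - y ^ 2) := by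
  rw [capGraph, cutoff_of_abs_le hab₁ hy, cutoff_of_abs_le hab₂ (hy.trans h12)]
  ring

/-- **Tail**: for `Y ≤ |y|` (with `0 < a₁ < b₁ ≤ Y`, `0 < a₂ < b₂ < Y`) the cap graph vanishes.
[folklore] -/
theorem capGraph_of_le_abs (ha₁ : 0 < a₁) (hab₁ : a₁ < b₁) (hb₁Y : b₁ ≤ Y) (ha₂ : 0 < a₂)
    (hab₂ : a₂ < b₂) (hb₂Y : b₂ < Y) {y : ℝ} (hy : Y ≤ |y|) :
    capGraph ρ₀ ρ₁ β a₁ b₁ a₂ b₂ Y y = 0 := by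
  rw [capGraph, cutoff_of_le_abs ha₁ hab₁ (hb₁Y.trans hy), cutoff_of_le_abs ha₂ hab₂ (hb₂Y.le.trans hy),
    plateau_of_le_abs hb₂Y hy]
  ring

/-- **Positivity** on `(-Y, Y)`: with `0 < a₁ < b₁ < ρ₀ ≤ a₂ < b₂ < ρ₁`, `b₂ < Y`, `0 < β`, the
cap graph is positive for `|y| < Y`. [folklore] -/
theorem capGraph_pos (ha₁ : 0 < a₁) (hab₁ : a₁ < b₁) (hb₁ : b₁ < ρ₀) (h0 : ρ₀ ≤ a₂)
    (hab₂ : a₂ < b₂) (hb₂ : b₂ < ρ₁) (hb₂Y : b₂ < Y) (hβ : 0 < β) {y : ℝ} (hy : |y| < Y) :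
    0 < capGraph ρ₀ ρ₁ β a₁ b₁ a₂ b₂ Y y := by
  have ha₂ : 0 < a₂ := by linarith
  obtain ⟨hc1, hc1'⟩ := cutoff_mem_Icc ha₁ hab₁ y
  obtain ⟨hc2, hc2'⟩ := cutoff_mem_Icc ha₂ hab₂ y
  obtain ⟨hp, hp'⟩ := plateau_mem_Icc b₂ Y y
  have hs0 : 0 ≤ Real.sqrt (ρ₀ ^ 2 - y ^ 2) := Real.sqrt_nonneg _
  have hs1 : 0 ≤ Real.sqrt (ρ₁ ^ 2 - y ^ 2) := Real.sqrt_nonneg _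
  have hsq : y ^ 2 = |y| ^ 2 := (sq_abs y).symm
  rw [capGraph]
  -- three regions: `|y| < ρ₀`, `ρ₀ ≤ |y| ≤ a₂` (still `< ρ₁`), `a₂ < |y| < Y`
  by_cases h1 : |y| < b₁
  · -- the first term is positive
    have hlt : cutoff a₁ b₁ y < 1 := cutoff_lt_one ha₁ hab₁ h1
    have hspos : 0 < Real.sqrt (ρ₀ ^ 2 - y ^ 2) :=
      Real.sqrt_pos.2 (by nlinarith [abs_nonneg y])
    have t1 : 0 < (1 - cutoff a₁ b₁ y) * Real.sqrt (ρ₀ ^ 2 - y ^ 2) := mul_pos (by linarith) hspos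
    have t2 : 0 ≤ cutoff a₁ b₁ y * (1 - cutoff a₂ b₂ y) * Real.sqrt (ρ₁ ^ 2 - y ^ 2) :=
      mul_nonneg (mul_nonneg hc1 (by linarith)) hs1
    have t3 : 0 ≤ cutoff a₂ b₂ y * β * plateau b₂ Y y := mul_nonneg (mul_nonneg hc2 hβ.le) hp
    linarith
  · push Not at h1
    by_cases h2 : |y| < b₂
    · -- the second term is positive
      have hc1one : cutoff a₁ b₁ y = 1 := cutoff_of_le_abs ha₁ hab₁ h1
      have hlt : cutoff a₂ b₂ y < 1 := cutoff_lt_one ha₂ hab₂ h2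
      have hspos : 0 < Real.sqrt (ρ₁ ^ 2 - y ^ 2) :=
        Real.sqrt_pos.2 (by nlinarith [abs_nonneg y])
      have t2 : 0 < cutoff a₁ b₁ y * (1 - cutoff a₂ b₂ y) * Real.sqrt (ρ₁ ^ 2 - y ^ 2) := by
        rw [hc1one, one_mul]; exact mul_pos (by linarith) hspos
      have t1 : 0 ≤ (1 - cutoff a₁ b₁ y) * Real.sqrt (ρ₀ ^ 2 - y ^ 2) := mul_nonneg (by linarith) hs0
      have t3 : 0 ≤ cutoff a₂ b₂ y * β * plateau b₂ Y y := mul_nonneg (mul_nonneg hc2 hβ.le) hp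
      linarith
    · -- the tail is positive
      push Not at h2
      have hc2one : cutoff a₂ b₂ y = 1 := cutoff_of_le_abs ha₂ hab₂ h2
      have hppos : 0 < plateau b₂ Y y := plateau_pos hb₂Y hy
      have t3 : 0 < cutoff a₂ b₂ y * β * plateau b₂ Y y := by
        rw [hc2one, one_mul]; exact mul_pos hβ hppos
      have t1 : 0 ≤ (1 - cutoff a₁ b₁ y) * Real.sqrt (ρ₀ ^ 2 - y ^ 2) := mul_nonneg (by linarith) hs0
      have t2 : 0 ≤ cutoff a₁ b₁ y * (1 - cutoff a₂ b₂ y) * Real.sqrt (ρ₁ ^ 2 - y ^ 2) :=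
        mul_nonneg (mul_nonneg hc1 (by linarith)) hs1
      linarith

/-- **Nonnegativity** everywhere (same hypotheses without `|y| < Y`). [folklore] -/
theorem capGraph_nonneg (ha₁ : 0 < a₁) (hab₁ : a₁ < b₁) (h0 : ρ₀ ≤ a₂) (hab₂ : a₂ < b₂)
    (hb₁ : b₁ < ρ₀) (hβ : 0 ≤ β) (y : ℝ) : 0 ≤ capGraph ρ₀ ρ₁ β a₁ b₁ a₂ b₂ Y y := by
  have ha₂ : 0 < a₂ := by linarith
  obtain ⟨hc1, hc1'⟩ := cutoff_mem_Icc ha₁ hab₁ y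
  obtain ⟨hc2, hc2'⟩ := cutoff_mem_Icc ha₂ hab₂ y
  obtain ⟨hp, -⟩ := plateau_mem_Icc b₂ Y y
  rw [capGraph]
  have t1 : 0 ≤ (1 - cutoff a₁ b₁ y) * Real.sqrt (ρ₀ ^ 2 - y ^ 2) :=
    mul_nonneg (by linarith) (Real.sqrt_nonneg _)
  have t2 : 0 ≤ cutoff a₁ b₁ y * (1 - cutoff a₂ b₂ y) * Real.sqrt (ρ₁ ^ 2 - y ^ 2) :=
    mul_nonneg (mul_nonneg hc1 (by linarith)) (Real.sqrt_nonneg _)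
  have t3 : 0 ≤ cutoff a₂ b₂ y * β * plateau b₂ Y y := mul_nonneg (mul_nonneg hc2 hβ) hp
  linarith

/-- **The cap graph stays outside the circle of radius `ρ₀`**: `√(ρ₀² - y²) ≤ capGraph y` for all
`y` (with `0 < a₁ < b₁ < ρ₀ ≤ a₂ < b₂`, `ρ₀ ≤ ρ₁`, `0 ≤ β`): on `|y| ≤ a₂` the value is a convex
combination of `√(ρ₀² - y²) ≤ √(ρ₁² - y²)`, and for `|y| ≥ a₂ ≥ ρ₀` the left side is `0`.
[folklore] -/
theorem sqrt_le_capGraph (ha₁ : 0 < a₁) (hab₁ : a₁ < b₁) (hb₁ : b₁ < ρ₀) (h0 : ρ₀ ≤ a₂)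
    (hab₂ : a₂ < b₂) (h01 : ρ₀ ≤ ρ₁) (hβ : 0 ≤ β) (y : ℝ) :
    Real.sqrt (ρ₀ ^ 2 - y ^ 2) ≤ capGraph ρ₀ ρ₁ β a₁ b₁ a₂ b₂ Y y := by
  have ha₂ : 0 < a₂ := by linarith
  have hρ₀ : 0 < ρ₀ := by linarith
  by_cases hy : |y| ≤ a₂
  · obtain ⟨hc1, hc1'⟩ := cutoff_mem_Icc ha₁ hab₁ y
    have hc2 : cutoff a₂ b₂ y = 0 := cutoff_of_abs_le hab₂ hy
    have hs : Real.sqrt (ρ₀ ^ 2 - y ^ 2) ≤ Real.sqrt (ρ₁ ^ 2 - y ^ 2) :=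
      Real.sqrt_le_sqrt (by nlinarith)
    rw [capGraph, hc2]
    nlinarith
  · push Not at hy
    have hzero : Real.sqrt (ρ₀ ^ 2 - y ^ 2) = 0 :=
      Real.sqrt_eq_zero'.2 (by nlinarith [sq_abs y, abs_nonneg y])
    rw [hzero]
    exact capGraph_nonneg ha₁ hab₁ h0 hab₂ hb₁ hβ y

/-- **The cap graph stays inside the pillbox**: `capGraph y ≤ max √(ρ₁² - y²) β` (with
`0 < a₁ < b₁ < ρ₀ ≤ a₂ < b₂`, `ρ₀ ≤ ρ₁`, `0 ≤ β`). [folklore] -/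
theorem capGraph_le_max (ha₁ : 0 < a₁) (hab₁ : a₁ < b₁) (hb₁ : b₁ < ρ₀) (h0 : ρ₀ ≤ a₂)
    (hab₂ : a₂ < b₂) (h01 : ρ₀ ≤ ρ₁) (hβ : 0 ≤ β) (y : ℝ) :
    capGraph ρ₀ ρ₁ β a₁ b₁ a₂ b₂ Y y ≤ max (Real.sqrt (ρ₁ ^ 2 - y ^ 2)) β := by
  have ha₂ : 0 < a₂ := by linarith
  obtain ⟨hc1, hc1'⟩ := cutoff_mem_Icc ha₁ hab₁ y
  obtain ⟨hc2, hc2'⟩ := cutoff_mem_Icc ha₂ hab₂ y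
  obtain ⟨hp, hp'⟩ := plateau_mem_Icc b₂ Y y
  have hs : Real.sqrt (ρ₀ ^ 2 - y ^ 2) ≤ Real.sqrt (ρ₁ ^ 2 - y ^ 2) :=
    Real.sqrt_le_sqrt (by nlinarith)
  have hs1 : 0 ≤ Real.sqrt (ρ₁ ^ 2 - y ^ 2) := Real.sqrt_nonneg _
  set M := max (Real.sqrt (ρ₁ ^ 2 - y ^ 2)) β with hM
  have hM1 : Real.sqrt (ρ₁ ^ 2 - y ^ 2) ≤ M := le_max_left _ _
  have hM2 : β ≤ M := le_max_right _ _
  rw [capGraph]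
  by_cases hy : |y| ≤ a₂
  · have hc20 : cutoff a₂ b₂ y = 0 := cutoff_of_abs_le hab₂ hy
    rw [hc20]
    nlinarith
  · push Not at hy
    have hc11 : cutoff a₁ b₁ y = 1 := cutoff_of_le_abs ha₁ hab₁ (by linarith)
    rw [hc11]
    nlinarith [mul_nonneg hc2 hβ]

end CapGraph

/-! ## The two graphs of the sweep -/

/-- **The fingertip graph** of the sweep at scale `(R, ε)`: the cap of radius `R + ε`, flank on
the circle of radius `R + 3ε/2`, tail of height `ε`, tips at `|y| = R + 2ε`. [folklore] -/
def tipGraph (R ε y : ℝ) : ℝ :=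
  capGraph (R + ε) (R + 3 / 2 * ε) ε (R / 2) (3 / 4 * R) (R + ε) (R + 5 / 4 * ε) (R + 2 * ε) y

/-- **The long-arc graph** of the sweep at scale `(R, ε)`: minus the cap of radius `R` (the long
arc of the push-off, read in the twisted chart), flank on the circle of radius `R + ε`, tail of
height `ε`, tips at `|y| = R + 2ε`. [folklore] -/
def longGraph (R ε y : ℝ) : ℝ :=
  -capGraph R (R + ε) ε (R / 2) (3 / 4 * R) (R + ε / 4) (R + ε / 2) (R + 2 * ε) y

section Scale

variable {R ε : ℝ} (hε : 0 < ε) (hεR : 4 * ε ≤ R)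
include hε hεR

/-- The fingertip graph is smooth. [folklore] -/
theorem contDiff_tipGraph : ContDiff ℝ ∞ (tipGraph R ε) := by
  unfold tipGraph
  exact contDiff_capGraph (by linarith) (by linarith) (by linarith) (by linarith) (by linarith)
    (by linarith)

/-- The long-arc graph is smooth. [folklore] -/
theorem contDiff_longGraph : ContDiff ℝ ∞ (longGraph R ε) := by
  unfold longGraph
  exact (contDiff_capGraph (by linarith) (by linarith) (by linarith) (by linarith) (by linarith)
    (by linarith)).neg

/-- Both graphs vanish off `(-(R + 2ε), R + 2ε)`. [folklore] -/
theorem tipGraph_of_le_abs {y : ℝ} (hy : R + 2 * ε ≤ |y|) : tipGraph R ε y = 0 := by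
  unfold tipGraph
  exact capGraph_of_le_abs (by linarith) (by linarith) (by linarith) (by linarith) (by linarith)
    (by linarith) hy

/-- Both graphs vanish off `(-(R + 2ε), R + 2ε)`. [folklore] -/
theorem longGraph_of_le_abs {y : ℝ} (hy : R + 2 * ε ≤ |y|) : longGraph R ε y = 0 := by
  unfold longGraph
  rw [capGraph_of_le_abs (by linarith) (by linarith) (by linarith) (by linarith) (by linarith)
    (by linarith) hy, neg_zero]

/-- The fingertip graph is positive on `(-(R + 2ε), R + 2ε)`. [folklore] -/
theorem tipGraph_pos {y : ℝ} (hy : |y| < R + 2 * ε) : 0 < tipGraph R ε y := by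
  unfold tipGraph
  exact capGraph_pos (by linarith) (by linarith) (by linarith) (by linarith) (by linarith)
    (by linarith) (by linarith) hε hy

/-- The long-arc graph is negative on `(-(R + 2ε), R + 2ε)`. [folklore] -/
theorem longGraph_neg {y : ℝ} (hy : |y| < R + 2 * ε) : longGraph R ε y < 0 := by
  unfold longGraph
  exact neg_neg_of_pos (capGraph_pos (by linarith) (by linarith) (by linarith) (by linarith)
    (by linarith) (by linarith) (by linarith) hε hy)

/-- **The middle of the long-arc graph is the circle of radius `R`**: for `|y| ≤ R/2`,
`longGraph y = -√(R² - y²)`. [folklore] -/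
theorem longGraph_of_abs_le {y : ℝ} (hy : |y| ≤ R / 2) :
    longGraph R ε y = -Real.sqrt (R ^ 2 - y ^ 2) := by
  unfold longGraph
  rw [capGraph_of_abs_le (by linarith) (by linarith) (by linarith) hy]

/-- **The middle of the fingertip graph is the circle of radius `R + ε`**: for `|y| ≤ R/2`,
`tipGraph y = √((R + ε)² - y²)`. [folklore] -/
theorem tipGraph_of_abs_le {y : ℝ} (hy : |y| ≤ R / 2) :
    tipGraph R ε y = Real.sqrt ((R + ε) ^ 2 - y ^ 2) := by
  unfold tipGraph
  rw [capGraph_of_abs_le (by linarith) (by linarith) (by linarith) hy]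

/-- **The long arc stays outside the push-off circle**: `R² ≤ (longGraph y)² + y²`. [folklore] -/
theorem sq_le_longGraph_sq_add_sq (y : ℝ) : R ^ 2 ≤ longGraph R ε y ^ 2 + y ^ 2 := by
  have h := sqrt_le_capGraph (ρ₀ := R) (ρ₁ := R + ε) (β := ε) (a₁ := R / 2) (b₁ := 3 / 4 * R)
    (a₂ := R + ε / 4) (b₂ := R + ε / 2) (Y := R + 2 * ε) (by linarith) (by linarith) (by linarith)
    (by linarith) (by linarith) (by linarith) hε.le y
  have hs : 0 ≤ Real.sqrt (R ^ 2 - y ^ 2) := Real.sqrt_nonneg _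
  have hsq : longGraph R ε y ^ 2 = (capGraph R (R + ε) ε (R / 2) (3 / 4 * R) (R + ε / 4) (R + ε / 2)
      (R + 2 * ε) y) ^ 2 := by rw [longGraph, neg_sq]
  rw [hsq]
  by_cases hy : y ^ 2 ≤ R ^ 2
  · have h2 : Real.sqrt (R ^ 2 - y ^ 2) ^ 2 = R ^ 2 - y ^ 2 := Real.sq_sqrt (by linarith)
    nlinarith
  · push Not at hy
    nlinarith [sq_nonneg (capGraph R (R + ε) ε (R / 2) (3 / 4 * R) (R + ε / 4) (R + ε / 2)
      (R + 2 * ε) y)]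

/-- **The fingertip stays outside the circle of radius `R + ε`**:
`(R + ε)² ≤ (tipGraph y)² + y²`. [folklore] -/
theorem sq_le_tipGraph_sq_add_sq (y : ℝ) : (R + ε) ^ 2 ≤ tipGraph R ε y ^ 2 + y ^ 2 := by
  have h := sqrt_le_capGraph (ρ₀ := R + ε) (ρ₁ := R + 3 / 2 * ε) (β := ε) (a₁ := R / 2)
    (b₁ := 3 / 4 * R) (a₂ := R + ε) (b₂ := R + 5 / 4 * ε) (Y := R + 2 * ε) (by linarith)
    (by linarith) (by linarith) (by linarith) (by linarith) (by linarith) hε.le y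
  have hs : 0 ≤ Real.sqrt ((R + ε) ^ 2 - y ^ 2) := Real.sqrt_nonneg _
  rw [← tipGraph] at h
  by_cases hy : y ^ 2 ≤ (R + ε) ^ 2
  · have h2 : Real.sqrt ((R + ε) ^ 2 - y ^ 2) ^ 2 = (R + ε) ^ 2 - y ^ 2 := Real.sq_sqrt (by linarith)
    nlinarith
  · push Not at hy
    nlinarith [sq_nonneg (tipGraph R ε y)]

/-- **Both graphs stay in the disc of radius `R + 5ε/2`**: `g(y)² + y² ≤ (R + 5ε/2)²` for
`|y| ≤ R + 2ε`, for `g = tipGraph` and `g = longGraph`. [folklore] -/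
theorem graph_sq_add_sq_le {y : ℝ} (hy : |y| ≤ R + 2 * ε) :
    tipGraph R ε y ^ 2 + y ^ 2 ≤ (R + 5 / 2 * ε) ^ 2 ∧
      longGraph R ε y ^ 2 + y ^ 2 ≤ (R + 5 / 2 * ε) ^ 2 := by
  have hy2 : y ^ 2 ≤ (R + 2 * ε) ^ 2 := by
    have := abs_le.1 hy
    nlinarith [sq_abs y, abs_nonneg y]
  have key : ∀ {ρ₀ ρ₁ a₂ b₂ : ℝ}, 0 < R / 2 → R / 2 < 3 / 4 * R → 3 / 4 * R < ρ₀ → ρ₀ ≤ a₂ →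
      a₂ < b₂ → ρ₀ ≤ ρ₁ → ρ₁ ≤ R + 3 / 2 * ε →
      (capGraph ρ₀ ρ₁ ε (R / 2) (3 / 4 * R) a₂ b₂ (R + 2 * ε) y) ^ 2 + y ^ 2 ≤ (R + 5 / 2 * ε) ^ 2 := by
    intro ρ₀ ρ₁ a₂ b₂ h1 h2 h3 h4 h5 h6 h7
    have hle := capGraph_le_max (Y := R + 2 * ε) h1 h2 h3 h4 h5 h6 hε.le y
    have hnn := capGraph_nonneg (Y := R + 2 * ε) (ρ₁ := ρ₁) h1 h2 h4 h5 h3 hε.le y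
    set g := capGraph ρ₀ ρ₁ ε (R / 2) (3 / 4 * R) a₂ b₂ (R + 2 * ε) y
    rcases le_total (Real.sqrt (ρ₁ ^ 2 - y ^ 2)) ε with hm | hm
    · rw [max_eq_right hm] at hle
      nlinarith
    · rw [max_eq_left hm] at hle
      by_cases hyy : y ^ 2 ≤ ρ₁ ^ 2
      · have h2' : Real.sqrt (ρ₁ ^ 2 - y ^ 2) ^ 2 = ρ₁ ^ 2 - y ^ 2 := Real.sq_sqrt (by linarith)
        have : g ^ 2 ≤ Real.sqrt (ρ₁ ^ 2 - y ^ 2) ^ 2 := by nlinarith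
        nlinarith
      · push Not at hyy
        have hz : Real.sqrt (ρ₁ ^ 2 - y ^ 2) = 0 := Real.sqrt_eq_zero'.2 (by linarith)
        rw [hz] at hle
        nlinarith
  constructor
  · unfold tipGraph
    exact key (by linarith) (by linarith) (by linarith) (by linarith) (by linarith) (by linarith)
      (by linarith)
  · rw [longGraph, neg_sq]
    exact key (by linarith) (by linarith) (by linarith) (by linarith) (by linarith) (by linarith)
      (by linarith)

/-- **Size of the displacement**: `|longGraph y - tipGraph y| ≤ 2R + 5ε`. [folklore] -/
theorem abs_longGraph_sub_tipGraph_le (y : ℝ) : |longGraph R ε y - tipGraph R ε y| ≤ 2 * R + 5 * ε := by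
  by_cases hy : |y| ≤ R + 2 * ε
  · obtain ⟨h1, h2⟩ := graph_sq_add_sq_le hε hεR hy
    have ht : tipGraph R ε y ^ 2 ≤ (R + 5 / 2 * ε) ^ 2 := by nlinarith [sq_nonneg y]
    have hl : longGraph R ε y ^ 2 ≤ (R + 5 / 2 * ε) ^ 2 := by nlinarith [sq_nonneg y]
    have ht' : |tipGraph R ε y| ≤ R + 5 / 2 * ε := abs_le_of_sq_le_sq' ht (by linarith) |>.2 |>
      fun h ↦ abs_le.2 ⟨(abs_le_of_sq_le_sq' ht (by linarith)).1, h⟩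
    have hl' : |longGraph R ε y| ≤ R + 5 / 2 * ε :=
      abs_le.2 (abs_le_of_sq_le_sq' hl (by linarith))
    calc |longGraph R ε y - tipGraph R ε y| ≤ |longGraph R ε y| + |tipGraph R ε y| := abs_sub _ _
      _ ≤ 2 * R + 5 * ε := by linarith
  · push Not at hy
    rw [longGraph_of_le_abs hε hεR hy.le, tipGraph_of_le_abs hε hεR hy.le, sub_zero, abs_zero]
    linarith

end Scale

end SlideSweep

end Literature.Topology.FourManifolds
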